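import Literature.AlgebraicGeometry.CossartPiltant200819.BareTower2008
import Mathlib.FieldTheory.Fixed
import Mathlib.FieldTheory.KummerPolynomial
import Mathlib.RingTheory.Norm.Transitivity
import Mathlib.RingTheory.Valuation.RamificationGroup
import HarnessLib

/-!
# Cossart–Piltant 2008, Theorem 7.2: the `(e, f)`-trichotomy at the degree-`p` steps

Sequel of `BareTower2008.lean`: clause **T-c** of the tower fact at the wild steps (HAL ms.
p. 20, proof of Thm 7.2: "each `Kᵢ/Kᵢ₋₁` with `i ≥ 2` is Galois of degree `p`, and both `Kᵢ`,
`Kᵢ₋₁` are the quotient field of a unique valuation ring … Consequently, either `e = p, f = 1`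
or `e = 1, f = p` or `e = f = 1` (immediate case)"). For a step `L/K` of degree `p = char K`
which is EITHER simple purely inseparable (`L = K(η)`, `ηᵖ ∈ K`) OR Galois with the valuation
ring `W` of `L` stabilised by the whole Galois group, we PROVE from the tree's fundamental
inequality `e·f ≤ [L:K]` (`ramificationIndex_mul_inertiaDegree_le_finrank`) that
`(e, f) ∈ {(1, 1), (p, 1), (1, p)}` — `trichotomy_of_pthRoot`, `trichotomy_of_isGalois`:
`IsImmediate K W ∨ (inertiaDegree K W = [L:K] ∨ ramificationIndex K W = [L:K])`.
Mechanism: every `y ∈ L` has `v(yᵖ) ∈ v(K^×)` (`yᵖ ∈ K`, resp. `v ∘ σ = v` so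
`v(yᵖ) = v(N_{L/K} y)`), whence `e ∈ {1, p}`; every residue `ȳ` has `ȳᵖ ∈ K̃`, or (Galois case)
the group acts on the residue field through a group of order `p` whose fixed field contains
`K̃`, whence `f ∈ {1, p}`; and `e·f ≤ p` excludes `(p, p)`. This is the disjunction `hef` of
`BMove3.primeUp` for the steps of `BMove3.galoisP` / `BMove3.inseparableP`.
[cite: CossartPiltant2008, Thm 7.2 proof (HAL pp. 20–21)]
-/

namespace Literature.AlgebraicGeometry.CossartPiltant200819.CP2008

open Literature.AlgebraicGeometry.Resolution IsLocalRing
open scoped Pointwise IntermediateField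

universe u

section GroupIndex

/-- A subgroup of index `≤ p` modulo which every element has `p`-power order has index `1`
or `p`. [folklore] -/
theorem index_eq_one_or_eq_of_pow_mem {G : Type*} [CommGroup G] (H : Subgroup G)
    [H.FiniteIndex] {p : ℕ} (hp : p.Prime) (hpow : ∀ g : G, ∃ n : ℕ, g ^ p ^ n ∈ H)
    (hle : H.index ≤ p) : H.index = 1 ∨ H.index = p := by
  haveI : Fact p.Prime := ⟨hp⟩
  have hP : IsPGroup p (G ⧸ H) := by
    intro q
    induction q using QuotientGroup.induction_on with
    | H g =>
      obtain ⟨n, hn⟩ := hpow g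
      exact ⟨n, by rw [← QuotientGroup.mk_pow, QuotientGroup.eq_one_iff]; exact hn⟩
  obtain ⟨n, hn⟩ := IsPGroup.iff_card.mp hP
  rw [← Subgroup.index] at hn
  rw [hn] at hle ⊢
  have hn1 : n ≤ 1 := (Nat.pow_le_pow_iff_right hp.one_lt).mp (by simpa using hle)
  interval_cases n <;> simp

end GroupIndex

section Residue

variable {E : Type*} [Field E]

/-- If every element of a field `E` of characteristic `p` has its `p`-th power in a subfield
`F` with `[E : F] ≤ p`, then `[E : F] ∈ {1, p}` (an element `r ∉ F` has minimal polynomial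
`Xᵖ - rᵖ`). [folklore] -/
theorem finrank_eq_one_or_eq_of_pow_mem (F : Subfield E) {p : ℕ} (hp : p.Prime)
    (hchar : (p : E) = 0) (hpow : ∀ r : E, r ^ p ∈ F) (hle : Module.finrank F E ≤ p)
    [Module.Finite F E] : Module.finrank F E = 1 ∨ Module.finrank F E = p := by
  haveI : Fact p.Prime := ⟨hp⟩
  haveI : CharP E p := (CharP.charP_iff_prime_eq_zero hp).mpr hchar
  by_cases h1 : Module.finrank F E = 1
  · exact Or.inl h1
  right
  -- an element outside `F`
  have hbt : (⊥ : Subalgebra F E) ≠ ⊤ := fun h =>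
    h1 (Subalgebra.bot_eq_top_iff_finrank_eq_one.mp h)
  obtain ⟨r, hr⟩ : ∃ r : E, r ∉ (⊥ : Subalgebra F E) := by
    by_contra h
    push Not at h
    exact hbt (eq_top_iff.mpr fun r _ => h r)
  have hrF : r ∉ F := by
    intro h
    exact hr (Algebra.mem_bot.mpr ⟨⟨r, h⟩, rfl⟩)
  -- its minimal polynomial is `X ^ p - C (r ^ p)`
  set a : F := ⟨r ^ p, hpow r⟩ with ha
  have hirr : Irreducible (Polynomial.X ^ p - Polynomial.C a) := by
    refine X_pow_sub_C_irreducible_of_prime hp fun b hb => hrF ?_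
    have hb' : (b : E) ^ p = r ^ p := by
      have := congrArg Subtype.val hb
      simpa [ha] using this
    have h0 : (r - b) ^ p = 0 := by rw [sub_pow_char, hb', sub_self]
    have : r = b := sub_eq_zero.mp (pow_eq_zero_iff hp.ne_zero |>.mp h0)
    rw [this]; exact b.2
  have hmonic : (Polynomial.X ^ p - Polynomial.C a).Monic :=
    Polynomial.monic_X_pow_sub_C a hp.ne_zero
  have hroot : Polynomial.aeval r (Polynomial.X ^ p - Polynomial.C a) = 0 := by
    simp only [map_sub, map_pow, Polynomial.aeval_X, Polynomial.aeval_C]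
    exact sub_eq_zero.mpr rfl
  have hmin : minpoly F r = Polynomial.X ^ p - Polynomial.C a :=
    (minpoly.eq_of_irreducible_of_monic hirr hroot hmonic).symm
  have hdeg : (minpoly F r).natDegree = p := by
    rw [hmin, Polynomial.natDegree_X_pow_sub_C]
  have hge : p ≤ Module.finrank F E := hdeg ▸ minpoly.natDegree_le r
  omega

end Residue

section Valuation

variable {K L : Type u} [Field K] [Field L] [Algebra K L]

/-- An automorphism stabilising the valuation ring `W` preserves the order of values:
`v(σ b) ≤ v(σ a) ↔ v b ≤ v a`. [folklore] -/
theorem valuation_map_le_map_iff (W : ValuationSubring L) (σ : L ≃ₐ[K] L) (hσ : σ • W = W)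
    (a b : L) : W.valuation (σ b) ≤ W.valuation (σ a) ↔ W.valuation b ≤ W.valuation a := by
  by_cases ha : a = 0
  · subst ha; simp
  have hσa : σ a ≠ 0 := (map_ne_zero σ).mpr ha
  have key : ∀ {x y : L}, y ≠ 0 →
      (W.valuation x ≤ W.valuation y ↔ x / y ∈ W) := by
    intro x y hy
    rw [← W.valuation_le_one_iff, map_div₀, div_le_one₀ ((Valuation.pos_iff _).mpr hy)]
  rw [key hσa, key ha, ← map_div₀]
  conv_rhs => rw [← ValuationSubring.smul_mem_pointwise_smul_iff (g := σ), hσ]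
  exact Iff.rfl

/-- No element has its value strictly increased by an automorphism (of finite order)
stabilising `W`. [folklore] -/
theorem not_valuation_lt_map [FiniteDimensional K L] (W : ValuationSubring L) (σ : L ≃ₐ[K] L)
    (hσ : σ • W = W) (y : L) : ¬ W.valuation y < W.valuation (σ y) := by
  intro hlt
  have hmono : ∀ {a b : L}, W.valuation a < W.valuation b →
      W.valuation (σ a) < W.valuation (σ b) := fun {a b} h =>
    not_le.mp fun h' => (not_le.mpr h) ((valuation_map_le_map_iff W σ hσ a b).mp h')
  have hstep : ∀ m : ℕ, W.valuation ((σ ^ m) y) < W.valuation (σ ((σ ^ m) y)) := by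
    intro m
    induction m with
    | zero => simpa using hlt
    | succ m ih =>
      rw [pow_succ', AlgEquiv.mul_apply]
      exact hmono ih
  have hchain : ∀ m : ℕ, W.valuation y < W.valuation ((σ ^ (m + 1)) y) := by
    intro m
    induction m with
    | zero => simpa using hlt
    | succ m ih =>
      rw [pow_succ', AlgEquiv.mul_apply]
      exact ih.trans (hstep (m + 1))
  obtain ⟨m, hm⟩ : ∃ m, orderOf σ = m + 1 := ⟨orderOf σ - 1, by have := orderOf_pos σ; omega⟩
  have := hchain m
  rw [← hm, pow_orderOf_eq_one, AlgEquiv.one_apply] at this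
  exact lt_irrefl _ this

/-- **`v ∘ σ = v`** for an automorphism stabilising the valuation ring (finite extension).
[folklore] -/
theorem valuation_map_eq [FiniteDimensional K L] (W : ValuationSubring L) (σ : L ≃ₐ[K] L)
    (hσ : σ • W = W) (y : L) : W.valuation (σ y) = W.valuation y := by
  have hσ' : σ⁻¹ • W = W := inv_smul_eq_iff.mpr hσ.symm
  refine le_antisymm (not_lt.mp (not_valuation_lt_map W σ hσ y)) (not_lt.mp ?_)
  have := not_valuation_lt_map W σ⁻¹ hσ' (σ y)
  simpa using this

/-- `e ∈ {1, p}` when every value has a `p`-power in `v(K^×)` and `e ≤ p`. [folklore] -/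
theorem ramificationIndex_eq_one_or_eq [FiniteDimensional K L] (W : ValuationSubring L) {p : ℕ}
    (hp : p.Prime)
    (hpow : ∀ y : L, y ≠ 0 → ∃ (n : ℕ) (c : K),
      W.valuation (y ^ p ^ n) = W.valuation (algebraMap K L c))
    (hle : ramificationIndex K W ≤ p) :
    ramificationIndex K W = 1 ∨ ramificationIndex K W = p := by
  haveI := (ramificationIndex_mul_inertiaDegree_le_finrank K W).1
  refine index_eq_one_or_eq_of_pow_mem (valueSubgroup K W) hp (fun γ => ?_) hle
  obtain ⟨y, hy⟩ := W.valuation_surjective (γ : ValuationSubring.ValueGroup W)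
  have hy0 : y ≠ 0 := by rintro rfl; rw [map_zero] at hy; exact γ.ne_zero hy.symm
  obtain ⟨n, c, hc⟩ := hpow y hy0
  refine ⟨n, (mem_valueSubgroup_iff K W _).mpr ⟨c, ?_, ?_⟩⟩
  · rintro rfl
    rw [map_zero, map_zero, map_pow, pow_eq_zero_iff (pow_ne_zero n hp.ne_zero)] at hc
    exact hy0 ((Valuation.zero_iff _).mp hc)
  · rw [Units.val_pow_eq_pow_val, ← hy, ← map_pow, hc]

/-- `f ∈ {1, p}` when every residue has its `p`-th power in `K̃` and `f ≤ p`
(`char = p`). [folklore] -/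
theorem inertiaDegree_eq_one_or_eq [FiniteDimensional K L] (W : ValuationSubring L) {p : ℕ}
    (hp : p.Prime) (hchar : (p : ResidueField W) = 0)
    (hpow : ∀ r : ResidueField W, r ^ p ∈ residueSubfield K W)
    (hle : inertiaDegree K W ≤ p) :
    inertiaDegree K W = 1 ∨ inertiaDegree K W = p := by
  haveI := (ramificationIndex_mul_inertiaDegree_le_finrank K W).2.1
  exact finrank_eq_one_or_eq_of_pow_mem (residueSubfield K W) hp hchar hpow hle

/-- Bookkeeping: `e, f ∈ {1, p}` and `e·f ≤ p = [L:K]` give the trichotomy. [folklore] -/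
theorem trichotomy_of_eq_one_or_eq [FiniteDimensional K L] (W : ValuationSubring L) {p : ℕ}
    (hp : p.Prime) (hdeg : Module.finrank K L = p)
    (he : ramificationIndex K W = 1 ∨ ramificationIndex K W = p)
    (hf : inertiaDegree K W = 1 ∨ inertiaDegree K W = p) :
    IsImmediate K W ∨
      (inertiaDegree K W = Module.finrank K L ∨ ramificationIndex K W = Module.finrank K L) := by
  have hle := (ramificationIndex_mul_inertiaDegree_le_finrank K W).2.2
  rcases he with he | he <;> rcases hf with hf | hf
  · exact Or.inl ⟨he, hf⟩
  · exact Or.inr (Or.inl (hf.trans hdeg.symm))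
  · exact Or.inr (Or.inr (he.trans hdeg.symm))
  · exfalso
    rw [he, hf, hdeg] at hle
    have := hp.one_lt
    nlinarith

/-- `e ≤ p` and `f ≤ p` from `e·f ≤ [L:K] = p` (`e, f ≥ 1`). [folklore] -/
theorem ramificationIndex_le_and_inertiaDegree_le [FiniteDimensional K L]
    (W : ValuationSubring L) {p : ℕ} (hdeg : Module.finrank K L = p) :
    ramificationIndex K W ≤ p ∧ inertiaDegree K W ≤ p := by
  obtain ⟨hfi, hfin, hle⟩ := ramificationIndex_mul_inertiaDegree_le_finrank K W
  rw [hdeg] at hle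
  have he : 1 ≤ ramificationIndex K W := Nat.one_le_iff_ne_zero.mpr hfi.index_ne_zero
  have hf : 1 ≤ inertiaDegree K W := by
    unfold inertiaDegree
    exact Module.finrank_pos
  constructor <;> nlinarith

/-- The residue field of a valuation ring of a field of characteristic `p` has
characteristic `p`. [folklore] -/
theorem natCast_residueField_eq_zero (W : ValuationSubring L) {p : ℕ} [CharP L p] :
    (p : ResidueField W) = 0 := by
  have : (p : W) = 0 := Subtype.ext (by simp)
  rw [← map_natCast (residue W), this, map_zero]

end Valuation

section PurelyInseparable

variable {K L : Type u} [Field K] [Field L] [Algebra K L]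

/-- In `L = K(η)` with `ηᵖ ∈ K` (`char K = p`), every element has its `p`-th power in `K`.
[folklore] -/
theorem exists_pow_eq_algebraMap_of_pthRoot {p : ℕ} [Fact p.Prime] [CharP K p] {η : L}
    {b₀ : K} (hη : η ^ p = algebraMap K L b₀) (hηtop : K⟮η⟯ = ⊤) (y : L) :
    ∃ c : K, y ^ p = algebraMap K L c := by
  haveI : CharP L p := charP_of_injective_algebraMap (algebraMap K L).injective p
  have hint : IsIntegral K η :=
    IsIntegral.of_pow (Fact.out : p.Prime).pos (hη ▸ isIntegral_algebraMap)
  have hy : y ∈ Algebra.adjoin K {η} := by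
    rw [← IntermediateField.adjoin_simple_toSubalgebra_of_isAlgebraic hint.isAlgebraic,
      IntermediateField.mem_toSubalgebra, hηtop]
    exact IntermediateField.mem_top
  induction hy using Algebra.adjoin_induction with
  | mem x hx =>
    rw [Set.mem_singleton_iff] at hx
    exact ⟨b₀, hx ▸ hη⟩
  | algebraMap c => exact ⟨c ^ p, by rw [map_pow]⟩
  | add x z _ _ hx hz =>
    obtain ⟨c, hc⟩ := hx
    obtain ⟨d, hd⟩ := hz
    exact ⟨c + d, by rw [add_pow_char, hc, hd, map_add]⟩
  | mul x z _ _ hx hz =>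
    obtain ⟨c, hc⟩ := hx
    obtain ⟨d, hd⟩ := hz
    exact ⟨c * d, by rw [mul_pow, hc, hd, map_mul]⟩

/-- **Trichotomy at a simple purely inseparable step of degree `p`**: for `L = K(η)`,
`ηᵖ ∈ K`, `[L:K] = p = char K` and ANY valuation ring `W` of `L`,
`(e, f) ∈ {(1,1), (1,p), (p,1)}`. [cite: CossartPiltant2008, Thm 7.2 proof (HAL p. 20)] -/
theorem trichotomy_of_pthRoot {p : ℕ} [Fact p.Prime] [CharP K p] [FiniteDimensional K L]
    (hdeg : Module.finrank K L = p) {η : L} {b₀ : K} (hη : η ^ p = algebraMap K L b₀)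
    (hηtop : K⟮η⟯ = ⊤) (W : ValuationSubring L) :
    IsImmediate K W ∨
      (inertiaDegree K W = Module.finrank K L ∨ ramificationIndex K W = Module.finrank K L) := by
  have hp : p.Prime := Fact.out
  haveI : CharP L p := charP_of_injective_algebraMap (algebraMap K L).injective p
  obtain ⟨hel, hfl⟩ := ramificationIndex_le_and_inertiaDegree_le W hdeg
  refine trichotomy_of_eq_one_or_eq W hp hdeg ?_ ?_
  · refine ramificationIndex_eq_one_or_eq W hp (fun y _ => ?_) hel
    obtain ⟨c, hc⟩ := exists_pow_eq_algebraMap_of_pthRoot hη hηtop y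
    exact ⟨1, c, by rw [pow_one, hc]⟩
  · refine inertiaDegree_eq_one_or_eq W hp (natCast_residueField_eq_zero W) (fun r => ?_) hfl
    obtain ⟨y, rfl⟩ := IsLocalRing.residue_surjective r
    obtain ⟨c, hc⟩ := exists_pow_eq_algebraMap_of_pthRoot hη hηtop (y : L)
    have hmem : algebraMap K L c ∈ W := by rw [← hc]; exact W.pow_mem y.2 p
    have : (residue W y) ^ p = residue W ⟨algebraMap K L c, hmem⟩ := by
      rw [← map_pow]
      exact congrArg (residue W) (Subtype.ext (by simpa using hc))
    rw [this]
    exact residue_mem_residueSubfield K W c hmem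

end PurelyInseparable

section Galois

variable {K L : Type u} [Field K] [Field L] [Algebra K L]

/-- An automorphism stabilising `W` maps `W` into itself. [folklore] -/
theorem map_mem_of_smul_eq (W : ValuationSubring L) (σ : L ≃ₐ[K] L) (hσ : σ • W = W) {y : L}
    (hy : y ∈ W) : σ y ∈ W := by
  have := ValuationSubring.smul_mem_pointwise_smul σ y W hy
  rwa [hσ] at this

/-- At a Galois step whose group stabilises `W`: `v(y ^ [L:K]) = v(N_{L/K} y)`. [folklore] -/
theorem valuation_pow_finrank_eq [FiniteDimensional K L] [IsGalois K L] (W : ValuationSubring L)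
    (hW : ∀ σ : L ≃ₐ[K] L, σ • W = W) (y : L) :
    W.valuation (y ^ Module.finrank K L) = W.valuation (algebraMap K L (Algebra.norm K y)) := by
  rw [Algebra.norm_eq_prod_automorphisms, map_prod, map_pow,
    Finset.prod_congr rfl fun σ _ => valuation_map_eq W σ (hW σ) y, Finset.prod_const,
    Finset.card_univ, ← Nat.card_eq_fintype_card, IsGalois.card_aut_eq_finrank]

/-- The norm of `y ∈ W` lies in `W`. [folklore] -/
theorem algebraMap_norm_mem [FiniteDimensional K L] [IsGalois K L] (W : ValuationSubring L)
    (hW : ∀ σ : L ≃ₐ[K] L, σ • W = W) (y : W) :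
    algebraMap K L (Algebra.norm K (y : L)) ∈ W := by
  rw [Algebra.norm_eq_prod_automorphisms]
  exact prod_mem fun σ _ => map_mem_of_smul_eq W σ (hW σ) y.2

/-- The residue of the norm of `y ∈ W` is the product of the translates of `ȳ` under the
(decomposition = whole) Galois group acting on the residue field. [folklore] -/
theorem residue_norm_eq [FiniteDimensional K L] [IsGalois K L] (W : ValuationSubring L)
    (hW : ∀ σ : L ≃ₐ[K] L, σ • W = W) (y : W) :
    residue W ⟨algebraMap K L (Algebra.norm K (y : L)), algebraMap_norm_mem W hW y⟩ =
      ∏ σ : L ≃ₐ[K] L, (⟨σ, hW σ⟩ : W.decompositionSubgroup K) • residue W y := by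
  have h : (⟨algebraMap K L (Algebra.norm K (y : L)), algebraMap_norm_mem W hW y⟩ : W) =
      ∏ σ : L ≃ₐ[K] L, ((⟨σ, hW σ⟩ : W.decompositionSubgroup K) • y) := by
    apply Subtype.ext
    rw [SubmonoidClass.coe_finsetProd]
    simp only [Algebra.norm_eq_prod_automorphisms]
    rfl
  rw [h, map_prod]
  rfl

/-- **Trichotomy at a Galois step of degree `p` with stabilised valuation ring**: for `L/K`
Galois, `[L:K] = p = char K`, and `W` with `σ • W = W` for every `σ` (i.e. `W` is the unique
extension of `W ∩ K`), `(e, f) ∈ {(1,1), (1,p), (p,1)}`.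
[cite: CossartPiltant2008, Thm 7.2 proof (HAL p. 20)] -/
theorem trichotomy_of_isGalois {p : ℕ} [Fact p.Prime] [CharP K p] [FiniteDimensional K L]
    [IsGalois K L] (hdeg : Module.finrank K L = p) (W : ValuationSubring L)
    (hW : ∀ σ : L ≃ₐ[K] L, σ • W = W) :
    IsImmediate K W ∨
      (inertiaDegree K W = Module.finrank K L ∨ ramificationIndex K W = Module.finrank K L) := by
  have hp : p.Prime := Fact.out
  haveI : CharP L p := charP_of_injective_algebraMap (algebraMap K L).injective p
  obtain ⟨hel, hfl⟩ := ramificationIndex_le_and_inertiaDegree_le W hdeg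
  haveI := (ramificationIndex_mul_inertiaDegree_le_finrank K W).2.1
  have he : ramificationIndex K W = 1 ∨ ramificationIndex K W = p :=
    ramificationIndex_eq_one_or_eq W hp
      (fun y _ => ⟨1, Algebra.norm K y, by rw [pow_one, ← hdeg, valuation_pow_finrank_eq W hW y]⟩)
      hel
  refine trichotomy_of_eq_one_or_eq W hp hdeg he ?_
  -- the Galois group acts on the residue field `E` with image `H` of order `1` or `p`
  set G := W.decompositionSubgroup K with hG
  set ρ := MulSemiringAction.toRingAut G (ResidueField W) with hρ
  set H := ρ.range with hH
  have hcardG : Nat.card G = p := by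
    have htop : G = ⊤ := (Subgroup.eq_top_iff' G).mpr fun σ => hW σ
    rw [htop, Subgroup.card_top, IsGalois.card_aut_eq_finrank, hdeg]
  have hdvd : Nat.card H ∣ p :=
    hcardG ▸ Subgroup.card_dvd_of_surjective ρ.rangeRestrict ρ.rangeRestrict_surjective
  have hf1 : 1 ≤ inertiaDegree K W := by unfold inertiaDegree; exact Module.finrank_pos
  rcases hp.eq_one_or_self_of_dvd _ hdvd with h1 | hP
  · -- `H = 1`: every residue has its `p`-th power (= residue of the norm) in `K̃`
    have htriv : ∀ (g : G) (r : ResidueField W), g • r = r := by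
      intro g r
      have hg : ρ g ∈ H := ⟨g, rfl⟩
      rw [Subgroup.card_eq_one.mp h1, Subgroup.mem_bot] at hg
      exact (RingEquiv.congr_fun hg r : ρ g r = r)
    refine inertiaDegree_eq_one_or_eq W hp (natCast_residueField_eq_zero W) (fun r => ?_) hfl
    obtain ⟨y, rfl⟩ := IsLocalRing.residue_surjective r
    have := residue_norm_eq W hW y
    simp_rw [htriv, Finset.prod_const, Finset.card_univ, ← Nat.card_eq_fintype_card,
      IsGalois.card_aut_eq_finrank, hdeg] at this
    rw [← this]
    exact residue_mem_residueSubfield K W _ _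
  · -- `|H| = p`: `K̃ ≤ Fix(H)` and `[E : Fix(H)] = p`, so `f = p`
    right
    haveI : Finite H := Nat.finite_of_card_ne_zero (by rw [hP]; exact hp.ne_zero)
    haveI : Fintype H := Fintype.ofFinite H
    have hfix : Module.finrank (FixedPoints.subfield H (ResidueField W)) (ResidueField W) = p := by
      rw [FixedPoints.finrank_eq_card, ← Nat.card_eq_fintype_card, hP]
    have hle' : residueSubfield K W ≤ FixedPoints.subfield H (ResidueField W) := by
      refine Subfield.closure_le.mpr ?_
      rintro _ ⟨c, hc, rfl⟩
      change _ ∈ MulAction.fixedPoints H (ResidueField W)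
      rw [MulAction.mem_fixedPoints]
      rintro ⟨_, g, rfl⟩
      change g • residue W ⟨algebraMap K L c, hc⟩ = residue W ⟨algebraMap K L c, hc⟩
      rw [← IsLocalRing.ResidueField.residue_smul]
      exact congrArg (residue W) (Subtype.ext ((g : L ≃ₐ[K] L).commutes c))
    letI : Algebra (residueSubfield K W) (FixedPoints.subfield H (ResidueField W)) :=
      (Subfield.inclusion hle').toAlgebra
    haveI : IsScalarTower (residueSubfield K W) (FixedPoints.subfield H (ResidueField W))
        (ResidueField W) := IsScalarTower.of_algebraMap_eq fun _ => rfl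
    have hmul := Module.finrank_mul_finrank (residueSubfield K W)
      (FixedPoints.subfield H (ResidueField W)) (ResidueField W)
    rw [hfix] at hmul
    change _ = inertiaDegree K W at hmul
    unfold inertiaDegree at hmul hfl hf1 ⊢
    rcases Nat.eq_zero_or_pos
        (Module.finrank (residueSubfield K W) (FixedPoints.subfield H (ResidueField W)))
      with h0 | hpos
    · rw [h0, zero_mul] at hmul
      omega
    · nlinarith

end Galois

end Literature.AlgebraicGeometry.CossartPiltant200819.CP2008
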